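import Mathlib
import HarnessLib
import Summits.NavierStokesRegularity.NavierStokesRegularity.Theorems.QuarterLogPincerSilencingCostDefs
import Literature.Analysis.FluidPDE.SuitableWeak
import Literature.Analysis.FluidPDE.LocalTypeI

/-!
# Route `QuarterLogPincer`, crux `TypeIQuantSubcubicExp` (stmt-NavierStokesRegularity-24077), line `cold_smoothing` —
# the line's OBJECTS, verbatim (Defs file)

VERBATIM port of the statement objects of ns-idea-7 g13's workfile `Cruxes/TypeIQuantSubcubicExp/Lines/cold_smoothing.lean`
(v1.1, c5ed8e646221; idea-crit-4 PASS 2026-08-29T08:47Z, re-stamp 09:42Z): §0 `Frame`, `Rate`, `ColdOn` (+ `coldOn_mono`), `ballGauge`;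
§1 the three plumbing stubs' statements CS1 `ColdCube`, CS2 `ColdPressureGauge`, CS3 `SmallEnergySmoothing`; §R Sa♭ `RegularAftermathM`; in the
namespace `…Cruxes.TypeIQuantSubcubicExp.ColdSmoothing`.  `Hot`/`Terminal`/`HotWitnessNear`/`TerminalEmberM` and `SilencingCost.BoxBound`/
`RegularAftermath` are IMPORTED from their homes.  Only textual change: `E3` unfolded (no notation); docstrings added where the workfile had
none.  No stub is proved here.  HONEST FRAME: Props about HYPOTHETICAL Type-I classical solutions over tree theorems (I1, ε-regularity,
pressure decay); nothing here bears on 24077's truth, W7 or Navier–Stokes regularity (OPEN / not proved).  pub-ns-dss typer (g38),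
`--supports stmt-NavierStokesRegularity-24077`; text by ns-idea-7 (g13).
-/

set_option linter.dupNamespace false

noncomputable section

open MeasureTheory Set Function Filter Topology Metric
open scoped ENNReal NNReal Classical
open Literature.Analysis Literature.Analysis.FluidPDE
open Summit.NavierStokesRegularity.NavierStokesRegularity.Cruxes.TypeIQuantSubcubicExp.BeadCensus
open Summit.NavierStokesRegularity.NavierStokesRegularity.Cruxes.TypeIQuantSubcubicExp.EmberCensus
  (Hot Terminal HotWitnessNear TerminalEmberM)

namespace Summit.NavierStokesRegularity.NavierStokesRegularity.Cruxes.TypeIQuantSubcubicExp.ColdSmoothing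

/-- The crux frame: classical on `[0,T] × ℝ³` (`ν = 1`, unforced) with square-integrable derivatives of all
orders (= `TaoFrame`). -/
def Frame (T : ℝ) (u : ℝ → (EuclideanSpace ℝ (Fin 3)) → (EuclideanSpace ℝ (Fin 3))) (p : ℝ → (EuclideanSpace ℝ (Fin 3)) → ℝ) : Prop :=
  IsClassicalNSSolutionOn (Icc 0 T) 1 0 u p ∧
    ∀ m : ℕ, ∃ C : NNReal, ∀ t ∈ Icc 0 T, eLpNorm (iteratedFDeriv ℝ m (u t)) 2 volume ≤ C

/-- The virtual Type-I rate `‖u(t,x)‖ ≤ M (T+τ−t)^{-1/2}` on `[0,T]` (sup-rate gauge of the crux). -/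
def Rate (M T τ : ℝ) (u : ℝ → (EuclideanSpace ℝ (Fin 3)) → (EuclideanSpace ℝ (Fin 3))) : Prop :=
  ∀ t ∈ Icc 0 T, ∀ x : (EuclideanSpace ℝ (Fin 3)), ‖u t x‖ ≤ M * (T + τ - t) ^ (-(1 / 2 : ℝ))

/-- `ε`-COLD on a space-time set (virtual blow-up time `T'`): `√(T'−t)·‖u(t,y)‖ ≤ ε` at each of its points. -/
def ColdOn (ε T' : ℝ) (u : ℝ → (EuclideanSpace ℝ (Fin 3)) → (EuclideanSpace ℝ (Fin 3))) (Q : Set (ℝ × (EuclideanSpace ℝ (Fin 3)))) : Prop :=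
  ∀ w ∈ Q, Real.sqrt (T' - w.1) * ‖u w.1 w.2‖ ≤ ε

/-- `ColdOn` is antitone in the set. -/
theorem coldOn_mono {ε T' : ℝ} {u : ℝ → (EuclideanSpace ℝ (Fin 3)) → (EuclideanSpace ℝ (Fin 3))} {Q Q' : Set (ℝ × (EuclideanSpace ℝ (Fin 3)))} (h : ColdOn ε T' u Q)
    (hQ : Q' ⊆ Q) : ColdOn ε T' u Q' := fun w hw => h w (hQ hw)

/-- The ball-gauge of the pressure at centre `x`, radius `ρ`: `p̃(t,y) = p(t,y) − ⨍_{B(x,ρ)} p(t)`. -/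
def ballGauge (p : ℝ → (EuclideanSpace ℝ (Fin 3)) → ℝ) (x : (EuclideanSpace ℝ (Fin 3))) (ρ : ℝ) : ℝ → (EuclideanSpace ℝ (Fin 3)) → ℝ :=
  fun t y => p t y - ⨍ w in ball x ρ, p t w

/-- **CS1 — `ColdCube` (size S–M; Hölder + the PROVED I1).**  For `M ≥ 1` there is `C₁ = C₁(M) > 0`: in the
frame with rate `M`, an `ε`-cold backward cylinder `Q_ρ(z)` with `ρ² ≤ z₁ ≤ T` has `cknC ρ z u ≤ C₁ε`.
Mechanism: `∫∫_{Q_ρ(z)}|u|³ ≤ ∫_{z₁−ρ²}^{z₁} (sup_{B_ρ(z₂)}|u(t)|)(∫_{B_ρ(z₂)}|u(t)|²)dt`; the slice energy is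
`≤ C(M)ρ` by the A-clause of `ThinCascade.stub_uniformScaledEnergy` (tree, PROVED) applied to the frame
restricted to `[0,z₁]` (`ThinCascade.frame_restrict`, `typeI_restrict`) at vertex `(x,r) = (z₂,ρ)`; coldness
gives `sup_{B_ρ}|u(t)| ≤ ε(T+τ−t)^{-1/2}` and `∫_{z₁−ρ²}^{z₁}(T+τ−t)^{-1/2}dt = 2(√(T+τ−z₁+ρ²) − √(T+τ−z₁)) ≤ 2ρ`;
so `cknC ρ z u = ρ⁻²∫∫|u|³ ≤ 2C(M)ε`; `C₁ := 2C(M)+1`.  Why it might fail: not as mathematics (Tonelli on the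
product set, measurability from classical smoothness).  Sources: I1 =
`Theorems/QuarterLogPincerTypeIQuantSubcubicExpStubUniformScaledEnergy.lean`; [CaffarelliKohnNirenberg1982 §2]. -/
def ColdCube : Prop :=
  ∀ M : ℝ, 1 ≤ M → ∃ C₁ : ℝ, 0 < C₁ ∧
    ∀ (T τ : ℝ) (u : ℝ → (EuclideanSpace ℝ (Fin 3)) → (EuclideanSpace ℝ (Fin 3))) (p : ℝ → (EuclideanSpace ℝ (Fin 3)) → ℝ), Frame T u p → 0 < τ → Rate M T τ u →
      ∀ (ε : ℝ) (z : ℝ × (EuclideanSpace ℝ (Fin 3))) (ρ : ℝ), 0 ≤ ε → 0 < ρ → ρ ^ 2 ≤ z.1 → z.1 ≤ T →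
        ColdOn ε (T + τ) u (parabolicCylinder ρ z) →
        cknC ρ z u ≤ ENNReal.ofReal (C₁ * ε)

/-- **CS2 — `ColdPressureGauge` (size M; the PROVED I1, D-clause, read in CKN variables).**  For `M ≥ 1` there is
`C₂ = C₂(M) > 0`: in the frame with rate `M`, for every backward cylinder `Q_ρ(z)` with `ρ² ≤ z₁ ≤ T`, the pair
`(u, p̃)` with the BALL-GAUGED pressure `p̃ = ballGauge p z₂ ρ` is a suitable weak solution in every parabolic ball
`Q_{ρ'}(z)`, `0 < ρ' ≤ ρ` (Albritton–Barker class `IsSuitableWeakSolutionInBall`), and `cknD ρ z p̃ ≤ C₂`.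
Mechanism: `∇p̃ = ∇p` and `t ↦ ⨍_{B}p(t)` is smooth, so `(u,p̃)` is classical on the closed cylinder
(`⊂ [0,T] × ℝ³` since `z₁ − ρ² ≥ 0`): `isSuitableWeakSolutionInBall_of_classical'` /
`isSuitableWeakSolutionOn_gauge_of_classical` (tree) with the energy, gradient and `L^{3/2}` classes from
continuity on a compact set; the bound is the D-clause of `ThinCascade.stub_uniformScaledEnergy` at vertex `z₁`
(frame restricted to `[0,z₁]`), radius `ρ`, centre `z₂`: `∫_{z₁−ρ²}^{z₁}∫_{B_ρ}|p − ⨍_{B_ρ}p|^{3/2} ≤ C(M)ρ²`, i.e.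
`cknD ρ z p̃ ≤ C(M)` (`Ioo ⊂ Icc`, iterated = product integral by Tonelli).  Why it might fail: not as
mathematics.  Sources: I1 (tree); [Lin1998] (the `L^{3/2}` pressure class); CKN 1982 §2. -/
def ColdPressureGauge : Prop :=
  ∀ M : ℝ, 1 ≤ M → ∃ C₂ : ℝ, 0 < C₂ ∧
    ∀ (T τ : ℝ) (u : ℝ → (EuclideanSpace ℝ (Fin 3)) → (EuclideanSpace ℝ (Fin 3))) (p : ℝ → (EuclideanSpace ℝ (Fin 3)) → ℝ), Frame T u p → 0 < τ → Rate M T τ u →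
      ∀ (z : ℝ × (EuclideanSpace ℝ (Fin 3))) (ρ : ℝ), 0 < ρ → ρ ^ 2 ≤ z.1 → z.1 ≤ T →
        (∀ ρ' : ℝ, 0 < ρ' → ρ' ≤ ρ → IsSuitableWeakSolutionInBall ρ' z u (ballGauge p z.2 ρ)) ∧
        cknD ρ z (ballGauge p z.2 ρ) ≤ ENNReal.ofReal C₂

/-- **CS3 — `SmallEnergySmoothing` (size M; the PROVED `seregin2014_lemma61` + parabolic zoom).**  There are absolute
`ε⋆ > 0` and `c⋆ ≥ 1`: if `u` is classical on `[0,T] × ℝ³` (any pressure `p`), `Q_r(z)` is a backward cylinder with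
`r² ≤ z₁ ≤ T`, `(u,q)` is a suitable weak solution in the parabolic ball `Q_r(z)` for SOME pressure `q`, and
`cknC r z u + cknD r z q < ε⋆`, then `‖∇ʲu(t,x)‖ ≤ c⋆ r^{-(j+1)}` for `t ∈ [z₁ − r²/4, z₁]`, `x ∈ B(z₂, r/2)`, `j ≤ 2`.
Mechanism: zoom `U(s,y) = r·u(z₁+r²s, z₂+ry)`, `P = r²q(…)` (`IsSuitableWeakSolutionInBall.zoom_radius`, tree):
`∫_{Q₁}(|U|³+|P|^{3/2}) = cknC r z u + cknD r z q < ε⋆ := ε₀` of `seregin2014_lemma61_holds` (tree, PROVED) ⇒ a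
representative `W` of `U` on `Q(1/2)` with `‖∇ᵏW‖ ≤ c₀ k`; `U` is continuous (classical), so `U = W` on `Q(1/2)`
(two continuous functions equal a.e. on an open set), the bounds transfer to `U` on the open cylinder and to its
closed time endpoints by `continuousWithinAt_iteratedFDeriv_slice` (tree); unzoom: `‖∇ʲu‖ = r^{-(j+1)}‖∇ʲU‖`;
`c⋆ := max(1, c₀ 0, c₀ 1, c₀ 2)`.  Why it might fail: not as mathematics (`iteratedFDeriv` of an affine
precomposition — the same algebra as `limit_silence`/`smooth_silence` L♯1).  Sources: [Seregin2014 Lemma 6.1,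
PDF p. 90]; CKN 1982 Prop. 1; Nečas–Růžička–Šverák 1996 Prop. 2.1; tree `SereginEpsilonRegularityHigherHolds`. -/
def SmallEnergySmoothing : Prop :=
  ∃ εs cs : ℝ, 0 < εs ∧ 1 ≤ cs ∧
    ∀ (T : ℝ) (u : ℝ → (EuclideanSpace ℝ (Fin 3)) → (EuclideanSpace ℝ (Fin 3))) (p q : ℝ → (EuclideanSpace ℝ (Fin 3)) → ℝ), Frame T u p →
      ∀ (z : ℝ × (EuclideanSpace ℝ (Fin 3))) (r : ℝ), 0 < r → r ^ 2 ≤ z.1 → z.1 ≤ T →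
        IsSuitableWeakSolutionInBall r z u q →
        cknC r z u + cknD r z q < ENNReal.ofReal εs →
        ∀ t ∈ Icc (z.1 - (r / 2) ^ 2) z.1, ∀ x ∈ ball z.2 (r / 2), ∀ j : ℕ, j ≤ 2 →
          ‖iteratedFDeriv ℝ j (u t) x‖ ≤ cs * r ^ (-((j : ℝ) + 1))

/-- **Sa♭ `RegularAftermathM`** — `SilencingCost.RegularAftermath` (tree `…QuarterLogPincerSilencingCostDefs`, text of
record) with the hotness cap allowed to depend on `M`: `∀ M ≥ 1, ∃ ε₁(M) > 0, ∀ ε ∈ (0,ε₁], ∃ M₁ ≥ 1, ∀ K ≥ 1, …`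
(body VERBATIM = Sa's, with `SilencingCost.BoxBound` BY NAME).  This is the form `ember_census` v1.2's E2♭
`TerminalEmberM` consumes (K2 fixes `M` first); `silencing_cost` v1.3 = `terminalEmberM_of_stubs` with Sa♭ in place
of Sa (custodial, same kernel).  PROVED below from CS1–CS3 (`regularAftermathM_of_stubs`); Sa ⇒ Sa♭ trivially. -/
def RegularAftermathM : Prop :=
  ∀ M : ℝ, 1 ≤ M → ∃ ε₁ : ℝ, 0 < ε₁ ∧ ∀ ε : ℝ, 0 < ε → ε ≤ ε₁ → ∃ M₁ : ℝ, 1 ≤ M₁ ∧ ∀ K : ℝ, 1 ≤ K →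
    ∀ (T τ : ℝ) (u : ℝ → (EuclideanSpace ℝ (Fin 3)) → (EuclideanSpace ℝ (Fin 3))) (p : ℝ → (EuclideanSpace ℝ (Fin 3)) → ℝ),
      (IsClassicalNSSolutionOn (Icc 0 T) 1 0 u p ∧
          ∀ m : ℕ, ∃ C : NNReal, ∀ t ∈ Icc 0 T, eLpNorm (iteratedFDeriv ℝ m (u t)) 2 volume ≤ C) →
        0 < τ →
        (∀ t ∈ Icc 0 T, ∀ x : (EuclideanSpace ℝ (Fin 3)), ‖u t x‖ ≤ M * (T + τ - t) ^ (-(1 / 2 : ℝ))) →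
        ∀ (t₁ : ℝ) (y : (EuclideanSpace ℝ (Fin 3))) (t : ℝ), t₁ ∈ Ioc 0 T → t ≤ t₁ →
          Hot ε (T + τ) u y t → Terminal K ε (T + τ) t₁ u y t →
          SilencingCost.BoxBound M₁ (Real.sqrt (T + τ - t)) u y (Icc t t₁) (2 * K * Real.sqrt (T + τ - t))

end Summit.NavierStokesRegularity.NavierStokesRegularity.Cruxes.TypeIQuantSubcubicExp.ColdSmoothing

end
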